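import Summits.BirchSwinnertonDyer.BirchSwinnertonDyer.Theorems.TwistFamilyManinDescentEisensteinResidualOfTrichotomy
import Summits.BirchSwinnertonDyer.BirchSwinnertonDyer.Theorems.ManinLocalTwoThreeManinPrimeToAdditiveFiveLeReducibleResidueThirteen
import HarnessLib

/-!
# Route `ManinLocalTwoThree`, residual crux C5 `ManinPrimeToAdditiveFiveLe` (stmt-BirchSwinnertonDyer-22969):
# core RED(13) of line `upper_anchor` ⟸ TFMD's LINE-12 items NotBottom (C1) ∧ StrongIsTop (C2), GRANTED
# Edixhoven's Kodaira form and Dokchitser–Dokchitser rigidity — a cross-route bridge by name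

Cell `pub/bsd-wall`, seat `bsd-line-ttd-p1` (g6; TTD prover working the TFMD LINE 12 glue). THEOREMS ONLY.

* `coreRED13_of_notBottom_of_strongIsTop` — hypothesis `h13` (core RED(13)) of the ML23 line ledger
  `maninPrimeToAdditiveFiveLe_of_print_mazurJ_of_kp57_of_cores` VERBATIM as conclusion (`p = 13`,
  `W[13]` reducible, globally twist-minimal, `ord₁₃ Δ_min ≤ 4`, (G)-ordinary, `13 ∣ deg φ`, lattice-optimal
  conductor-level datum ⟹ `13 ∤ c`), from TFMD's `EisensteinOrdinaryTwistLatticeNotBottom` (C1, item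
  25939), `EisensteinOrdinaryStrongIsTop` (C2, item 26929), Edixhoven 1991 Thm. 3 Kodaira form and the rigidity
  fact `dokchitser_padicValInt_minimalDiscriminantInt_eq_of_isogeny_of_potentiallyGoodOrdinary`, by the
  TFMD core `EisensteinTrichotomy.not_dvd_c_of_notBottom_of_strongIsTop` (the twist-minimality and
  `13 ∣ deg φ` binders are carried, not used).
* `maninPrimeToAdditiveFiveLe_of_print_mazurJ_of_kp57_of_red57_of_twistedLatticeItems` — C5 BY NAME ⟸ the
  eight printed facts of the ML23 ledger + KP57 + core RED(57) + C1 + C2 + rigidity: the `p = 13`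
  reducible core of X₅ is DISCHARGED MODULO TFMD's two LINE-12 cruxes.

HONEST STATUS. Conditional-result (`--supports 22969 --as helper`): C1, C2, KP57, RED(57) are OPEN and
every printed input is a cite-only `def … : Prop`. Nothing here proves BSD, Manin's conjecture or C5.
[cite: EdixhovenManin1991, Thm. 3 and §4] [cite: DokchitserDokchitser2015LocalInvariants, Thm. 5.1 (1)]
[cite: Mazur1978, Thm. 1]
-/

set_option autoImplicit false
-- single-conjunct summit: `Summit.BirchSwinnertonDyer.BirchSwinnertonDyer.…` repeats the name by design
set_option linter.dupNamespace false

noncomputable section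

open scoped Classical NumberField

namespace Summit.BirchSwinnertonDyer.BirchSwinnertonDyer.Theorems

open WeierstrassCurve IsDedekindDomain NumberField
  Literature.NumberTheory.EllipticCurves Literature.NumberTheory.EllipticCurves.ModularForms
  Literature.NumberTheory.EllipticCurves.Rank1Residual
  Summit.BirchSwinnertonDyer.Rank1Residual.ManinAdditive
  Summit.BirchSwinnertonDyer.Rank1Residual.Additive
  Summit.BirchSwinnertonDyer.BirchSwinnertonDyer.Theses.EdixhovenFibreFiveSeven
  Summit.BirchSwinnertonDyer.BirchSwinnertonDyer.Theses.TwistFamilyManinDescent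

/-- **Core RED(13) of ML23's line `upper_anchor` ⟸ TFMD's C1 ∧ C2, GRANTED Edixhoven's Kodaira form and
rigidity** (hypothesis `h13` of `maninPrimeToAdditiveFiveLe_of_print_mazurJ_of_kp57_of_cores` VERBATIM):
the TFMD core `EisensteinTrichotomy.not_dvd_c_of_notBottom_of_strongIsTop` read on the `p = 13` binders
(modularity is the fourth antecedent; global twist-minimality and `13 ∣ deg φ` are not used).
[cite: EdixhovenManin1991, Thm. 3 and §4] [cite: DokchitserDokchitser2015LocalInvariants, Thm. 5.1 (1)] -/
theorem coreRED13_of_notBottom_of_strongIsTop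
    (hC1 : EisensteinOrdinaryTwistLatticeNotBottom) (hC2 : EisensteinOrdinaryStrongIsTop)
    (hEdK : edixhoven_not_dvd_maninConstant_of_kodairaSymbol_ne)
    (hDD : dokchitser_padicValInt_minimalDiscriminantInt_eq_of_isogeny_of_potentiallyGoodOrdinary) :
    mazur_not_dvd_maninConstant_of_odd → abbesUllmo_not_dvd_maninConstant_of_not_dvd_level →
    cesnavicius_not_two_dvd_maninConstant_of_two_dvd_level → exists_isNewformOf →
    ∀ (W : WeierstrassCurve ℚ) [W.IsElliptic] [W.IsGloballyMinimal] [NeZero (W.conductorNorm ℤ)]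
      (D : ModularParametrizationData W (W.conductorNorm ℤ)),
      IsLatticeOptimal D → ∀ p : ℕ, p.Prime → p = 13 → p ^ 2 ∣ W.conductorNorm ℤ →
      ¬ (∃ (W' : WeierstrassCurve ℚ) (q : ℕ), W'.IsElliptic ∧ W'.IsGloballyMinimal ∧ q.Prime ∧
          q ≠ 2 ∧ q ^ 2 ∣ W.conductorNorm ℤ ∧
          IsIsogenous W (W'.quadraticTwist (((-1 : ℤ) ^ (q / 2) * q : ℤ) : ℚ)) ∧
          ¬ q ^ 2 ∣ W'.conductorNorm ℤ) →
      ¬ (∃ (W' : WeierstrassCurve ℚ) (d : ℤ), W'.IsElliptic ∧ W'.IsGloballyMinimal ∧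
          (d = -1 ∨ d = 2 ∨ d = -2) ∧ 2 ^ 2 ∣ W.conductorNorm ℤ ∧
          IsIsogenous W (W'.quadraticTwist (d : ℚ)) ∧ ¬ 2 ^ 2 ∣ W'.conductorNorm ℤ) →
      ¬ W.HasIrreducibleModPGaloisRep p →
      padicValInt p W.minimalDiscriminantInt ≤ 4 →
      (∃ (L : Type) (_ : Field L) (_ : NumberField L) (_ : IsCyclotomicExtension {p} ℚ L)
          (F : IntermediateField ℚ L),
          ∀ w : HeightOneSpectrum (𝓞 F), (p : 𝓞 F) ∈ w.asIdeal →
            (W.baseChange F).HasGoodReductionAt w ∧ (W.baseChange F).HasUnitRootAt w) →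
      p ∣ D.modularDegree →
      ¬ (p : ℤ) ∣ D.maninConstant := by
  intro _hM _hAU _hC hnf W _ _ _ D hD p hp hp13 hpN _hodd _hdy hred hlow hGo _hdeg
  haveI : Fact p.Prime := ⟨hp⟩
  exact Summit.BirchSwinnertonDyer.BirchSwinnertonDyer.Theorems.TwistFamilyManinDescent.EisensteinTrichotomy.not_dvd_c_of_notBottom_of_strongIsTop
    hnf hC1 hC2 hEdK hDD W p D hpN hp13
    hred hGo hlow hD

/-- **C5 `ManinPrimeToAdditiveFiveLe` BY NAME ⟸ eight printed facts + KP57 + RED(57) + TFMD's C1 ∧ C2**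
(conditional-result; C5 is NOT proved): the ML23 line ledger
`maninPrimeToAdditiveFiveLe_of_print_mazurJ_of_kp57_of_cores` with its core RED(13) discharged by
`coreRED13_of_notBottom_of_strongIsTop`. Binders: Kato F′ (`hK`), Kato F″ (`hK57`), ČNS Thm. 1.2 (`hCNS`),
Cremona ≤ 5·10⁵ (`h500k`), KP57 BY NAME (`hKP57`), Edixhoven Thm. 3 Kodaira / ordinarity forms (`hEdK`,
`hEdG`), Mazur's list (`hJ`), Dokchitser–Dokchitser rigidity (`hDD`), TFMD items C1 (`hC1`) and C2 (`hC2`),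
and the open core RED(57) (`h57`). [cite: Mazur1978, Thm. 1] [cite: EdixhovenManin1991, Thm. 3]
[cite: CesnaviciusNeururerSaha2023, Thm. 1.2] [cite: DokchitserDokchitser2015LocalInvariants, Thm. 5.1 (1)] -/
theorem maninPrimeToAdditiveFiveLe_of_print_mazurJ_of_kp57_of_red57_of_twistedLatticeItems
    (hK : kato_neron_isIntegral_twistedSymbolSum_of_additive)
    (hK57 : kato_neron_isIntegral_twistedSymbolSum_of_additive_five_le)
    (hCNS : cesnaviciusNeururerSaha_padicVal_maninConstant_le_modularDegree)
    (h500k : cremona_abs_maninConstant_eq_one_of_level_le_500000)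
    (hKP57 : KPResidueManinUnitFiveSeven)
    (hEdK : edixhoven_not_dvd_maninConstant_of_kodairaSymbol_ne)
    (hEdG : edixhoven_not_dvd_maninConstant_of_not_potentiallyGoodOrdinary)
    (hJ : mazur_j_mem_of_not_hasIrreducibleModPGaloisRep_of_eleven_le)
    (hDD : dokchitser_padicValInt_minimalDiscriminantInt_eq_of_isogeny_of_potentiallyGoodOrdinary)
    (hC1 : EisensteinOrdinaryTwistLatticeNotBottom) (hC2 : EisensteinOrdinaryStrongIsTop)
    (h57 : mazur_not_dvd_maninConstant_of_odd → abbesUllmo_not_dvd_maninConstant_of_not_dvd_level →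
    cesnavicius_not_two_dvd_maninConstant_of_two_dvd_level → exists_isNewformOf →
    ∀ (W : WeierstrassCurve ℚ) [W.IsElliptic] [W.IsGloballyMinimal] [NeZero (W.conductorNorm ℤ)]
      (D : ModularParametrizationData W (W.conductorNorm ℤ)),
      IsLatticeOptimal D → ∀ p : ℕ, p.Prime → (p = 5 ∨ p = 7) → p ^ 2 ∣ W.conductorNorm ℤ →
      ¬ (∃ (W' : WeierstrassCurve ℚ) (q : ℕ), W'.IsElliptic ∧ W'.IsGloballyMinimal ∧ q.Prime ∧
          q ≠ 2 ∧ q ^ 2 ∣ W.conductorNorm ℤ ∧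
          IsIsogenous W (W'.quadraticTwist (((-1 : ℤ) ^ (q / 2) * q : ℤ) : ℚ)) ∧
          ¬ q ^ 2 ∣ W'.conductorNorm ℤ) →
      ¬ (∃ (W' : WeierstrassCurve ℚ) (d : ℤ), W'.IsElliptic ∧ W'.IsGloballyMinimal ∧
          (d = -1 ∨ d = 2 ∨ d = -2) ∧ 2 ^ 2 ∣ W.conductorNorm ℤ ∧
          IsIsogenous W (W'.quadraticTwist (d : ℚ)) ∧ ¬ 2 ^ 2 ∣ W'.conductorNorm ℤ) →
      ¬ W.HasIrreducibleModPGaloisRep p →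
      ¬ (p : ℤ) ∣ D.maninConstant) :
    Summit.BirchSwinnertonDyer.BirchSwinnertonDyer.Theses.ManinLocalTwoThree.ManinPrimeToAdditiveFiveLe :=
  maninPrimeToAdditiveFiveLe_of_print_mazurJ_of_kp57_of_cores hK hK57 hCNS h500k hKP57 hEdK hEdG hJ h57
    (coreRED13_of_notBottom_of_strongIsTop hC1 hC2 hEdK hDD)

end Summit.BirchSwinnertonDyer.BirchSwinnertonDyer.Theorems

end
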